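import Summits.CriticalPhenomena.PercolationContinuityZ3.Theorems.PercNearOneGluingNoHeavyLowerTailIncStarDegreeTwoRoot
import Summits.CriticalPhenomena.PercolationContinuityZ3.Theorems.PercNearOneGluingNoHeavyLowerTailSahiRootSideSep
import Literature.Probability.Percolation.Crossings
import HarnessLib

/-!
# Degree-two root, I: the pinned laws ARE root-set cluster laws of `G − s` (the root-fibre dictionary)

Support file for the Sahi programme (`--supports stmt-CriticalPhenomena-4575`, prover prim-sahi-p2 gen 29).  No definitions, no named facts, no
sorries; standard axioms.  Memo `run/shared/lean/prim/prim-sahi/FROM-prim-sahi-p2-gen29-ROOT-FIBRE-DICHOTOMY.md` §1–§2, `prim-sahi-p2/PROOF-E3.md` §39.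

At a root `s` of degree two (neighbours `u ≠ v`, no other pair of positive weight at `s`) the four pinned laws `P^{ab} = P_{w[s(s,u)↦a][s(s,v)↦b]}`
of `EdgeInduction.sahiE3_twoBond` see the principal hub events `{C_s ⊇ U}` (`U ∌ s`) as ROOT-SET events of `G − s` under the ORIGINAL law:
`P¹⁰(C_s ⊇ U) = P(U ⊆ C_u^{sᶜ})`, `P⁰¹(C_s ⊇ U) = P(U ⊆ C_v^{sᶜ})`, `P¹¹(C_s ⊇ U) = P(U ⊆ C_u^{sᶜ} ∪ C_v^{sᶜ})` (`real_pin_principal`; the two-separator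
decomposition `SahiRootSide.real_principal_rootSide_eq` with root side `{s}`, the pinned root cells, and locality of the outside events) — the
dictionary of the ROOT-FIBRE CALCULUS (memo §1): the tensor-Bernstein coefficients of the star at a degree-two root are polarised cubics of THREE
INDEPENDENT percolations on `G − s` with root sets drawn from `{u, v}`.  The sequel `…IncStarDegreeTwoRootFibreOneOne` uses it to prove the mixed fibre
`RF11 = 2M(W) + 4A(W) + 4B(W) − Σ_t (A(t)B(W∖t) + B(t)A(W∖t)) ≥ 0` and to discharge the hypothesis `h11` of `incStar_nonneg_of_degTwoRoot`.
-/

noncomputable section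

namespace Summit.CriticalPhenomena.PercolationContinuityZ3.Theorems

namespace IncStar

open MeasureTheory Set Literature.Probability.Percolation Literature.Probability.LatticeModels EdgeInduction
open scoped Classical

variable {n : ℕ}

/-! ### Root pairs: connection through the pairs meeting `{s}` is adjacency -/

/-- Joining `s` to `x ≠ s` using only pairs that meet `{s}` means that the pair `s(s,x)` itself is open. [this work] -/
theorem inter_rootPairs_mem_openConn_iff (s x : Fin n) (hx : x ≠ s) (ω : BondConfig (Fin n)) :
    ω ∩ {e : Sym2 (Fin n) | ∃ y ∈ ((({s} : Finset (Fin n)) : Set (Fin n))), y ∈ e} ∈ (openConn s x : Set (BondConfig (Fin n)))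
      ↔ s(s, x) ∈ ω := by
  set F : Set (Sym2 (Fin n)) := {e : Sym2 (Fin n) | ∃ y ∈ ((({s} : Finset (Fin n)) : Set (Fin n))), y ∈ e} with hF
  have hmemF : ∀ e : Sym2 (Fin n), e ∈ F ↔ s ∈ e := by
    intro e; simp [hF]
  constructor
  · intro h
    have h' : (openGraph (ω ∩ F)).Reachable s x := h
    rw [SimpleGraph.reachable_iff_reflTransGen] at h'
    rcases Relation.ReflTransGen.cases_tail h' with h0 | ⟨z, -, hzx⟩
    · exact absurd h0 hx
    · rw [openGraph, SimpleGraph.fromEdgeSet_adj, Set.mem_inter_iff, hmemF] at hzx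
      obtain ⟨⟨hzxω, hsmem⟩, hzx'⟩ := hzx
      rw [Sym2.mem_iff] at hsmem
      rcases hsmem with hsz | hsx
      · rw [← hsz] at hzxω; exact hzxω
      · exact absurd hsx.symm hx
  · intro h
    have hadj : (openGraph (ω ∩ F)).Adj s x := by
      rw [openGraph, SimpleGraph.fromEdgeSet_adj, Set.mem_inter_iff, hmemF]
      exact ⟨⟨h, Sym2.mem_mk_left _ _⟩, hx.symm⟩
    exact hadj.reachable

/-! ### The pinned root cells -/

/-- Under a weight taking the values `0/1` at the two root pairs `e₁ = s(s,u) ≠ e₂ = s(s,v)`, an event decided by the states of `e₁, e₂`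
through a Boolean test `φ` has probability `1` or `0` according to `φ` at the pinned values. [this work] -/
theorem real_rootCell_pin (w : Sym2 (Fin n) → unitInterval) {s u v : Fin n} (hus : u ≠ s) (hvs : v ≠ s) (hne : s(s, u) ≠ s(s, v))
    (a b : Bool) (φ : Prop → Prop → Prop) :
    (pin₂ w s(s, u) s(s, v) (if a then 1 else 0) (if b then 1 else 0)).real
        {ω | φ (ω ∩ {e : Sym2 (Fin n) | ∃ y ∈ ((({s} : Finset (Fin n)) : Set (Fin n))), y ∈ e} ∈ (openConn s u : Set (BondConfig (Fin n))))
               (ω ∩ {e : Sym2 (Fin n) | ∃ y ∈ ((({s} : Finset (Fin n)) : Set (Fin n))), y ∈ e} ∈ (openConn s v : Set (BondConfig (Fin n))))}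
      = if φ (a = true) (b = true) then 1 else 0 := by
  set W : Sym2 (Fin n) → unitInterval :=
    Function.update (Function.update w s(s, u) (if a then 1 else 0)) s(s, v) (if b then 1 else 0) with hW
  have hpin : pin₂ w s(s, u) s(s, v) (if a then 1 else 0) (if b then 1 else 0) = prodBernoulli W := rfl
  rw [hpin]
  have hWu : W s(s, u) = if a then 1 else 0 := by
    simp only [hW, Function.update_of_ne hne, Function.update_self]
  have hWv : W s(s, v) = if b then 1 else 0 := by
    simp only [hW, Function.update_self]
  set G : Set (BondConfig (Fin n)) := {ω | ∀ e, W e = 1 → e ∈ ω} ∩ {ω | ∀ e, W e = 0 → e ∉ ω} with hGdef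
  have hG : (prodBernoulli W).real G = 1 := real_sureSet W
  have hm : MeasurableSet G := MeasurableSet.of_discrete
  -- on `G` the two root states are the pinned values
  have hstate : ∀ ω ∈ G, ((s(s, u) ∈ ω) ↔ a = true) ∧ ((s(s, v) ∈ ω) ↔ b = true) := by
    intro ω hω
    have h1 : ∀ e, W e = 1 → e ∈ ω := hω.1
    have h0 : ∀ e, W e = 0 → e ∉ ω := hω.2
    constructor
    · cases a
      · simp only [Bool.false_eq_true, iff_false]
        exact h0 _ (by rw [hWu]; simp)
      · simp only [iff_true]
        exact h1 _ (by rw [hWu]; simp)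
    · cases b
      · simp only [Bool.false_eq_true, iff_false]
        exact h0 _ (by rw [hWv]; simp)
      · simp only [iff_true]
        exact h1 _ (by rw [hWv]; simp)
  set X : Set (BondConfig (Fin n)) :=
    {ω | φ (ω ∩ {e : Sym2 (Fin n) | ∃ y ∈ ((({s} : Finset (Fin n)) : Set (Fin n))), y ∈ e} ∈ (openConn s u : Set (BondConfig (Fin n))))
           (ω ∩ {e : Sym2 (Fin n) | ∃ y ∈ ((({s} : Finset (Fin n)) : Set (Fin n))), y ∈ e} ∈ (openConn s v : Set (BondConfig (Fin n))))} with hX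
  rw [real_eq_real_inter_of_real_eq_one hm hG X]
  have hXG : ∀ ω ∈ G, (ω ∈ X ↔ φ (a = true) (b = true)) := by
    intro ω hω
    obtain ⟨hu', hv'⟩ := hstate ω hω
    simp only [hX, Set.mem_setOf_eq, inter_rootPairs_mem_openConn_iff s u hus, inter_rootPairs_mem_openConn_iff s v hvs]
    rw [propext hu', propext hv']
  by_cases hφ : φ (a = true) (b = true)
  · rw [if_pos hφ]
    have : X ∩ G = G := by
      ext ω; constructor
      · exact fun h => h.2
      · exact fun h => ⟨(hXG ω h).2 hφ, h⟩
    rw [this, hG]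
  · rw [if_neg hφ]
    have : X ∩ G = ∅ := Set.subset_empty_iff.1 fun ω h => hφ ((hXG ω h.2).1 h.1)
    rw [this, measureReal_empty]

/-! ### The dictionary: pinned principal probabilities are root-set probabilities of `G − s` -/

/-- **Dictionary.**  At a root of degree two, for a nonempty target set `U ∌ s` and pinned values `a, b ∈ {0,1}` of the two root pairs:
`P^{ab}(C_s ⊇ U) = [a=1,b=0]·P(U ⊆ C_u^{sᶜ}) + [a=0,b=1]·P(U ⊆ C_v^{sᶜ}) + [a=1,b=1]·P(U ⊆ C_u^{sᶜ} ∪ C_v^{sᶜ})`, the right-hand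
probabilities under the ORIGINAL weight `w` (outside events are determined by the pairs missing `s`, where the pinned weights agree with `w`). [this work] -/
theorem real_pin_principal (w : Sym2 (Fin n) → unitInterval) {s u v : Fin n} (hus : u ≠ s) (hvs : v ≠ s) (huv : u ≠ v)
    (hw : ∀ z : Fin n, z ≠ s → z ≠ u → z ≠ v → w s(s, z) = 0) (a b : Bool)
    (U : Finset (Fin n)) (hU0 : U.Nonempty) (hU : ∀ t ∈ U, t ≠ s) :
    (pin₂ w s(s, u) s(s, v) (if a then 1 else 0) (if b then 1 else 0)).real (⋂ t ∈ U, (openConn s t : Set (BondConfig (Fin n)))) =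
      (if a = true ∧ b = false then 1 else 0) *
          (prodBernoulli w).real (⋂ t ∈ U, (openConnIn ((({s} : Finset (Fin n)) : Set (Fin n)))ᶜ u t : Set (BondConfig (Fin n))))
      + (if a = false ∧ b = true then 1 else 0) *
          (prodBernoulli w).real (⋂ t ∈ U, (openConnIn ((({s} : Finset (Fin n)) : Set (Fin n)))ᶜ v t : Set (BondConfig (Fin n))))
      + (if a = true ∧ b = true then 1 else 0) *
          (prodBernoulli w).real (⋂ t ∈ U, (openConnIn ((({s} : Finset (Fin n)) : Set (Fin n)))ᶜ u t ∪
              openConnIn ((({s} : Finset (Fin n)) : Set (Fin n)))ᶜ v t : Set (BondConfig (Fin n)))) := by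
  have hne : s(s, u) ≠ s(s, v) := by
    intro h; rw [Sym2.eq_iff] at h
    rcases h with ⟨-, h⟩ | ⟨-, h⟩
    · exact huv h
    · exact hus h
  set W : Sym2 (Fin n) → unitInterval :=
    Function.update (Function.update w s(s, u) (if a then 1 else 0)) s(s, v) (if b then 1 else 0) with hW
  have hpin : pin₂ w s(s, u) s(s, v) (if a then 1 else 0) (if b then 1 else 0) = prodBernoulli W := rfl
  -- the pinned weight has the no-exit property for the root side `{s}`
  have hs : s ∈ ({s} : Finset (Fin n)) := Finset.mem_singleton_self s
  have hW' : ∀ x ∈ ({s} : Finset (Fin n)), ∀ z, z ∉ ({s} : Finset (Fin n)) → z ≠ u → z ≠ v → W s(x, z) = 0 := by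
    intro x hx z hz hzu hzv
    rw [Finset.mem_singleton] at hx hz
    subst hx
    have hz1 : s(x, z) ≠ s(x, v) := by
      intro h; rw [Sym2.eq_iff] at h
      rcases h with ⟨-, h⟩ | ⟨-, h⟩
      · exact hzv h
      · exact hz h
    have hz2 : s(x, z) ≠ s(x, u) := by
      intro h; rw [Sym2.eq_iff] at h
      rcases h with ⟨-, h⟩ | ⟨-, h⟩
      · exact hzu h
      · exact hz h
    simp only [hW, Function.update_of_ne hz1, Function.update_of_ne hz2]
    exact hw z hz hzu hzv
  have hUs : ∀ t ∈ U, t ∉ ({s} : Finset (Fin n)) := fun t ht h => hU t ht (Finset.mem_singleton.1 h)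
  have key := SahiRootSide.real_principal_rootSide_eq W ({s} : Finset (Fin n)) hs hW' U hU0 hUs
  rw [hpin, key]
  -- the three root cells under the pinned law
  have c1 := real_rootCell_pin w hus hvs hne a b (fun p q => p ∧ ¬ q)
  have c2 := real_rootCell_pin w hus hvs hne a b (fun p q => ¬ p ∧ q)
  have c3 := real_rootCell_pin w hus hvs hne a b (fun p q => p ∧ q)
  rw [hpin] at c1 c2 c3
  rw [c1, c2, c3]
  -- the outside events have the same probability under `W` and `w`
  have hm : ∀ X : Set (BondConfig (Fin n)), MeasurableSet X := fun _ => MeasurableSet.of_discrete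
  have hpq : ∀ e ∈ ({e : Sym2 (Fin n) | ∃ y ∈ ((({s} : Finset (Fin n)) : Set (Fin n))), y ∈ e}ᶜ : Set (Sym2 (Fin n))),
      W e = w e := by
    intro e he
    simp only [Set.mem_compl_iff, Set.mem_setOf_eq, Finset.coe_singleton, Set.mem_singleton_iff, exists_eq_left] at he
    have h1 : e ≠ s(s, v) := fun h => he (by rw [h]; exact Sym2.mem_mk_left _ _)
    have h2 : e ≠ s(s, u) := fun h => he (by rw [h]; exact Sym2.mem_mk_left _ _)
    simp only [hW, Function.update_of_ne h1, Function.update_of_ne h2]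
  have hdO : ∀ x t : Fin n, DeterminedBy (openConnIn ((({s} : Finset (Fin n)) : Set (Fin n)))ᶜ x t : Set (BondConfig (Fin n)))
      {e : Sym2 (Fin n) | ∃ y ∈ ((({s} : Finset (Fin n)) : Set (Fin n))), y ∈ e}ᶜ :=
    fun x t => SahiRootSide.determinedBy_openConnIn_compl _ x t
  have hO : ∀ x : Fin n,
      (prodBernoulli W).real (⋂ t ∈ U, (openConnIn ((({s} : Finset (Fin n)) : Set (Fin n)))ᶜ x t : Set (BondConfig (Fin n)))) =
      (prodBernoulli w).real (⋂ t ∈ U, (openConnIn ((({s} : Finset (Fin n)) : Set (Fin n)))ᶜ x t : Set (BondConfig (Fin n)))) := by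
    intro x
    refine prodBernoulli_real_eq_of_determinedBy W w hpq ((determinedBy_iff _ _).2 fun ω ω' h => ?_) (hm _)
    simp only [Set.mem_iInter]
    exact forall₂_congr fun t _ => (determinedBy_iff _ _).1 (hdO x t) ω ω' h
  have hOuv : (prodBernoulli W).real (⋂ t ∈ U, (openConnIn ((({s} : Finset (Fin n)) : Set (Fin n)))ᶜ u t ∪
        openConnIn ((({s} : Finset (Fin n)) : Set (Fin n)))ᶜ v t : Set (BondConfig (Fin n)))) =
      (prodBernoulli w).real (⋂ t ∈ U, (openConnIn ((({s} : Finset (Fin n)) : Set (Fin n)))ᶜ u t ∪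
        openConnIn ((({s} : Finset (Fin n)) : Set (Fin n)))ᶜ v t : Set (BondConfig (Fin n)))) := by
    refine prodBernoulli_real_eq_of_determinedBy W w hpq ((determinedBy_iff _ _).2 fun ω ω' h => ?_) (hm _)
    simp only [Set.mem_iInter, Set.mem_union]
    exact forall₂_congr fun t _ => or_congr ((determinedBy_iff _ _).1 (hdO u t) ω ω' h)
      ((determinedBy_iff _ _).1 (hdO v t) ω ω' h)
  rw [hO u, hO v, hOuv]
  cases a <;> cases b <;> simp

/-! ### Corollaries of the dictionary in the shapes used by Sahi's cubic -/

section Shapes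

variable (w : Sym2 (Fin n) → unitInterval) {s u v : Fin n}

/-- `⋂` over a singleton finset. [folklore] -/
theorem rootFibre_biInter_single (f : Fin n → Set (BondConfig (Fin n))) (b : Fin n) :
    (⋂ t ∈ ({b} : Finset (Fin n)), f t) = f b := by
  rw [Finset.set_biInter_singleton]

/-- `⋂` over a two-element finset. [folklore] -/
theorem rootFibre_biInter_pair (f : Fin n → Set (BondConfig (Fin n))) (b c : Fin n) :
    (⋂ t ∈ ({b, c} : Finset (Fin n)), f t) = f b ∩ f c := by
  rw [Finset.set_biInter_insert, Finset.set_biInter_singleton]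

/-- `⋂` over a three-element finset. [folklore] -/
theorem rootFibre_biInter_triple (f : Fin n → Set (BondConfig (Fin n))) (b c y : Fin n) :
    (⋂ t ∈ ({b, c, y} : Finset (Fin n)), f t) = f b ∩ f c ∩ f y := by
  rw [Finset.set_biInter_insert, Finset.set_biInter_insert, Finset.set_biInter_singleton, Set.inter_assoc]

/-- Dictionary, law `P¹⁰`, general target set: `P¹⁰(C_s ⊇ U) = P(U ⊆ C_u^{sᶜ})`. [this work] -/
theorem real_pin10_principal (hus : u ≠ s) (hvs : v ≠ s) (huv : u ≠ v)
    (hw : ∀ z : Fin n, z ≠ s → z ≠ u → z ≠ v → w s(s, z) = 0) (U : Finset (Fin n)) (hU0 : U.Nonempty)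
    (hU : ∀ t ∈ U, t ≠ s) :
    (pin₂ w s(s, u) s(s, v) 1 0).real (⋂ t ∈ U, (openConn s t : Set (BondConfig (Fin n)))) =
      (prodBernoulli w).real (⋂ t ∈ U, (openConnIn ((({s} : Finset (Fin n)) : Set (Fin n)))ᶜ u t : Set (BondConfig (Fin n)))) := by
  have h := real_pin_principal w hus hvs huv hw true false U hU0 hU
  simpa using h

/-- Dictionary, law `P⁰¹`, general target set: `P⁰¹(C_s ⊇ U) = P(U ⊆ C_v^{sᶜ})`. [this work] -/
theorem real_pin01_principal (hus : u ≠ s) (hvs : v ≠ s) (huv : u ≠ v)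
    (hw : ∀ z : Fin n, z ≠ s → z ≠ u → z ≠ v → w s(s, z) = 0) (U : Finset (Fin n)) (hU0 : U.Nonempty)
    (hU : ∀ t ∈ U, t ≠ s) :
    (pin₂ w s(s, u) s(s, v) 0 1).real (⋂ t ∈ U, (openConn s t : Set (BondConfig (Fin n)))) =
      (prodBernoulli w).real (⋂ t ∈ U, (openConnIn ((({s} : Finset (Fin n)) : Set (Fin n)))ᶜ v t : Set (BondConfig (Fin n)))) := by
  have h := real_pin_principal w hus hvs huv hw false true U hU0 hU
  simpa using h

/-- Dictionary, law `P¹¹`, general target set: `P¹¹(C_s ⊇ U) = P(U ⊆ C_u^{sᶜ} ∪ C_v^{sᶜ})`. [this work] -/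
theorem real_pin11_principal (hus : u ≠ s) (hvs : v ≠ s) (huv : u ≠ v)
    (hw : ∀ z : Fin n, z ≠ s → z ≠ u → z ≠ v → w s(s, z) = 0) (U : Finset (Fin n)) (hU0 : U.Nonempty)
    (hU : ∀ t ∈ U, t ≠ s) :
    (pin₂ w s(s, u) s(s, v) 1 1).real (⋂ t ∈ U, (openConn s t : Set (BondConfig (Fin n)))) =
      (prodBernoulli w).real (⋂ t ∈ U, (openConnIn ((({s} : Finset (Fin n)) : Set (Fin n)))ᶜ u t ∪
        openConnIn ((({s} : Finset (Fin n)) : Set (Fin n)))ᶜ v t : Set (BondConfig (Fin n)))) := by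
  have h := real_pin_principal w hus hvs huv hw true true U hU0 hU
  simpa using h

end Shapes

end IncStar

end Summit.CriticalPhenomena.PercolationContinuityZ3.Theorems

end
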